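import Summits.AnomalousDissipation.AnomalousDissipation.Theorems.SawtoothPulseCascadeLipAgmonShearSlot
import Literature.Analysis.FluidPDE.TorusLinearisedNSVorticityGradientGrowth
import HarnessLib

/-!
# Per-half-pulse bounds for the vorticity derivatives of a planar linearised response along a shear
(route `AnomalousDissipation/SawtoothPulseCascade`, line `lip-agmon` of the crux ApproxSol58 =
stmt-AnomalousDissipation-19688; lead g4, module E-concrete, part 2 — abstract slot)

For a classical solution `(w, q)` of the Navier–Stokes equations linearised at a SHEAR background `u`
on a window `[a, b] × 𝕋²` with force `g` (`∂ₖu = 0`, `|⟪∂ₖ'u, v⟫| ≤ r|vₖ|`, `|⟪∂ₖ'∂ₖ'u, v⟫| ≤ rκ₁|vₖ|`,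
cumulative strain `∫ₐᵗ r ≤ Γ`), with derivative caps of the background vorticity
`|∂ₘΩ̄| ≤ rκ₁`, `|∂ₖ∂ₘΩ̄| ≤ rκ₂`, `|∂ₗ∂ₖ∂ₘΩ̄| ≤ rκ₃`, `‖∇Ω̄‖ ≤ rκ₁`, size caps of the force curl
`c = ∂₀g₁ − ∂₁g₀` (`‖c‖₂ ≤ rλ₀`, `‖∇c‖₂ ≤ rλ₁`, `(Σ‖∂∂c‖₂²)^½ ≤ rλ₂`) and an `L²` envelope `‖w(τ)‖₂ ≤ e`,
the response vorticity `ω = ∂₀w₁ − ∂₁w₀` obeys, uniformly in `ν ≥ 0`, for all `t ∈ [a, b]`: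

* level 0: `‖ω(t)‖₂ ≤ ‖ω(a)‖₂ + Γ(λ₀ + κ₁e) =: Z⁺` (`response_slot_level_zero`);
* level 1: `‖∂ₖω(t)‖₂ + ‖∂ₖ'ω(t)‖₂ ≤ (1+Γ)(‖∂ₖω(a)‖₂ + ‖∂ₖ'ω(a)‖₂) + (2+Γ)Γ P₁`,
  `P₁ = λ₁ + 2(κ₁Z⁺ + √2 κ₂ e)` (`response_slot_level_one`);
* level 2: the three second derivatives, by the unipotent matrix of `…LipAgmonShearSlot` with
  `P₂ = λ₂ + 2(κ₁S⁺ + 2√2κ₂Z⁺ + 2κ₃e)` (`response_slot_level_two`).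

The sources are the tree's aggregate bounds `Torus.sqrt_scalarGradNormSq_vorticitySource_le_fin_two` /
`Torus.sqrt_sum_vorticitySource_le_fin_two` (p497833, ad-lit g13) for `c − ⟪w, ∇Ω̄⟩`, the packaging
`Torus.linearisedNSForced_isClassicalScalarTransportForcedOn_vorticity_fin_two` (p491169) and the slot
summaries `slot_level_one/two` (p501618).
-/

set_option linter.dupNamespace false

noncomputable section

namespace Summit.AnomalousDissipation.AnomalousDissipation.Theorems.SawtoothPulseCascade.LipAgmon

open Set MeasureTheory intervalIntegral
open scoped InnerProductSpace ContDiff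
open Literature.Analysis Literature.Analysis.FunctionSpaces Literature.Analysis.FluidPDE
open Literature.Analysis.FluidPDE.Torus Literature.Analysis.FunctionSpaces.Torus

/-! ## §1 Small `L²` facts -/

section L2

variable {d : Type*} [Fintype d] [DecidableEq d]

/-- `‖∂ₘf‖₂ ≤ ‖∇f‖₂` for smooth scalars. [folklore] -/
theorem sqrt_integral_partialDeriv_sq_le_sqrt_scalarGradNormSq {f : UnitAddTorus d → ℝ} (hf : IsSmooth f)
    (m : d) : Real.sqrt (∫ x, (Torus.partialDeriv m f x) ^ 2) ≤ Real.sqrt (scalarGradNormSq f) := by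
  refine Real.sqrt_le_sqrt ?_
  rw [scalarGradNormSq_eq_sum_integral hf]
  exact Finset.single_le_sum (f := fun i => ∫ x, (Torus.partialDeriv i f x) ^ 2)
    (fun i _ => integral_nonneg fun x => sq_nonneg _) (Finset.mem_univ m)

/-- `‖∂ᵢ∂ₖf‖₂ ≤ (Σₘ Σⱼ ‖∂ₘ∂ⱼf‖₂²)^½`. [folklore] -/
theorem sqrt_integral_pdpd_sq_le_sqrt_sum (f : UnitAddTorus d → ℝ) (i k : d) :
    Real.sqrt (∫ x, (Torus.partialDeriv i (Torus.partialDeriv k f) x) ^ 2) ≤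
      Real.sqrt (∑ m, ∑ j, ∫ x, (Torus.partialDeriv m (Torus.partialDeriv j f) x) ^ 2) := by
  refine Real.sqrt_le_sqrt ?_
  have h1 : ∫ x, (Torus.partialDeriv i (Torus.partialDeriv k f) x) ^ 2 ≤
      ∑ j, ∫ x, (Torus.partialDeriv i (Torus.partialDeriv j f) x) ^ 2 :=
    Finset.single_le_sum (f := fun j => ∫ x, (Torus.partialDeriv i (Torus.partialDeriv j f) x) ^ 2)
      (fun j _ => integral_nonneg fun x => sq_nonneg _) (Finset.mem_univ k)
  exact h1.trans (Finset.single_le_sum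
    (f := fun m => ∑ j, ∫ x, (Torus.partialDeriv m (Torus.partialDeriv j f) x) ^ 2)
    (fun m _ => Finset.sum_nonneg fun j _ => integral_nonneg fun x => sq_nonneg _) (Finset.mem_univ i))

/-- On `𝕋²`: `‖∇f‖₂ ≤ ‖∂₀f‖₂ + ‖∂₁f‖₂`. [folklore] -/
theorem sqrt_scalarGradNormSq_le_add_fin_two {f : UnitAddTorus (Fin 2) → ℝ} (hf : IsSmooth f) :
    Real.sqrt (scalarGradNormSq f) ≤
      Real.sqrt (∫ x, (Torus.partialDeriv 0 f x) ^ 2) + Real.sqrt (∫ x, (Torus.partialDeriv 1 f x) ^ 2) := by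
  rw [scalarGradNormSq_eq_sum_integral hf, Fin.sum_univ_two]
  -- `√(A + B) ≤ √A + √B` (cf. `MRT2015.sqrt_add_le_sqrt_add_sqrt`, not imported here)
  have hA : 0 ≤ ∫ x, (Torus.partialDeriv 0 f x) ^ 2 := integral_nonneg fun x => sq_nonneg _
  have hB : 0 ≤ ∫ x, (Torus.partialDeriv 1 f x) ^ 2 := integral_nonneg fun x => sq_nonneg _
  refine Real.sqrt_le_iff.2 ⟨add_nonneg (Real.sqrt_nonneg _) (Real.sqrt_nonneg _), ?_⟩
  have hA' := Real.sq_sqrt hA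
  have hB' := Real.sq_sqrt hB
  nlinarith [mul_nonneg (Real.sqrt_nonneg (∫ x, (Torus.partialDeriv 0 f x) ^ 2))
    (Real.sqrt_nonneg (∫ x, (Torus.partialDeriv 1 f x) ^ 2))]

omit [DecidableEq d] in
/-- `‖⟪w, G⟫‖_{L²} ≤ M ‖w‖_{L²}` when `‖G(x)‖ ≤ M` pointwise (continuous `w`, `G`, `M ≥ 0`). [folklore] -/
theorem sqrt_integral_inner_sq_le' {w G : UnitAddTorus d → EuclideanSpace ℝ d} (hw : Continuous w)
    (hG : Continuous G) {M : ℝ} (hM : 0 ≤ M) (hle : ∀ x, ‖G x‖ ≤ M) :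
    Real.sqrt (∫ x, ⟪w x, G x⟫_ℝ ^ 2) ≤ M * Real.sqrt (∫ x, ‖w x‖ ^ 2) := by
  have h := sqrt_integral_sq_le_mul (f := fun x => ⟪w x, G x⟫_ℝ) (g := fun x => ‖w x‖) (hw.inner hG) hw.norm hM
    (fun x => ?_)
  · have e : (∫ x, (fun x => ‖w x‖) x ^ 2) = ∫ x, ‖w x‖ ^ 2 := rfl
    simpa using h
  · rw [abs_of_nonneg (norm_nonneg _)]
    calc |⟪w x, G x⟫_ℝ| ≤ ‖w x‖ * ‖G x‖ := abs_real_inner_le_norm _ _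
      _ ≤ ‖w x‖ * M := mul_le_mul_of_nonneg_left (hle x) (norm_nonneg _)
      _ = M * ‖w x‖ := mul_comm _ _

end L2


/-! ## §2 The response over one half pulse -/

section Slot

/-- **The planar linearised response over one half pulse of a shear: levels 0, 1, 2.**
Window `[a, b]`, `ν ≥ 0`; background `u` jointly smooth, divergence free, with the shear structure
`∂ₖu = 0`, `|⟪∂ₖ'u, v⟫| ≤ r|vₖ|`, `|⟪∂ₖ'∂ₖ'u, v⟫| ≤ rκ₁|vₖ|` (`r ≥ 0` continuous, `∫ₐᵗ r ≤ Γ`), whose vorticity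
`Ω̄ = W(u)₀₁` has `‖∇Ω̄‖ ≤ rκ₁`, `|∂ₘΩ̄| ≤ rκ₁`, `|∂ₖ∂ₘΩ̄| ≤ rκ₂`, `|∂ₗ∂ₖ∂ₘΩ̄| ≤ rκ₃`; classical `(w, q)` with
`∂ₜw + (u·∇)w + (w·∇)u = νΔw − ∇q + g`, `div w = 0`, `‖w(τ)‖₂ ≤ e`, force curl `c = ∂₀g₁ − ∂₁g₀` with
`‖c‖₂ ≤ rλ₀`, `‖∇c‖₂ ≤ rλ₁`, `(Σ‖∂∂c‖₂²)^½ ≤ rλ₂`. Then for `t ∈ [a, b]`, with `ω = W(w)₀₁`,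
`Z⁺ = ‖ω(a)‖₂ + Γ(λ₀ + κ₁e)`, `P₁ = λ₁ + 2(κ₁Z⁺ + √2κ₂e)`,
`S⁺ = (1+Γ)(‖∂ₖω(a)‖₂ + ‖∂ₖ'ω(a)‖₂) + (2+Γ)ΓP₁`, `P₂ = λ₂ + 2(κ₁S⁺ + 2√2κ₂Z⁺ + 2κ₃e)`:
`‖ω(t)‖₂ ≤ Z⁺`; `‖∂ₖω(t)‖₂ + ‖∂ₖ'ω(t)‖₂ ≤ S⁺`; and
`‖∂ₖ∂ₖω(t)‖₂ + ‖∂ₖ∂ₖ'ω(t)‖₂ + ‖∂ₖ'∂ₖ'ω(t)‖₂ ≤ (1+Γ+Γ²)(their values at a + 3ΓP₂) + Γκ₁(‖∂ₖω(a)‖₂ + ΓP₁)`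
— uniformly in `ν ≥ 0` (vorticity equation of the response as a forced passive scalar,
`Torus.linearisedNSForced_isClassicalScalarTransportForcedOn_vorticity_fin_two`; aggregate source bounds
`Torus.sqrt_scalarGradNormSq_vorticitySource_le_fin_two` / `sqrt_sum_vorticitySource_le_fin_two`; unipotent
slot summaries `slot_level_one/two`). [cite: MajdaBertozzi2002, §3.2 Prop. 3.7 (energy estimates for derivatives, uniform in the viscosity)] -/
theorem response_slot_bounds {a b ν : ℝ} (hab : a < b) (hν : 0 ≤ ν)
    {u w g : ℝ → UnitAddTorus (Fin 2) → EuclideanSpace ℝ (Fin 2)} {q : ℝ → UnitAddTorus (Fin 2) → ℝ}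
    (hu : Torus.IsSmoothSpaceTimeOn (Icc a b) u) (hudiv : ∀ t ∈ Icc a b, Torus.IsDivFree (u t))
    (hw : Torus.IsSmoothSpaceTimeOn (Icc a b) w) (hq : Torus.IsSmoothSpaceTimeOn (Icc a b) q)
    (hwdiv : ∀ t ∈ Icc a b, Torus.IsDivFree (w t))
    (hlin : ∀ t ∈ Icc a b, ∀ x, Torus.timeDerivWithin (Icc a b) w t x + Torus.convect (u t) (w t) x +
      Torus.convect (w t) (u t) x = ν • Torus.laplacian (w t) x - Torus.gradient (q t) x + g t x)
    {k k' : Fin 2} (hkk' : k ≠ k') {r : ℝ → ℝ} (hr : Continuous r) (hr0 : ∀ τ ∈ Icc a b, 0 ≤ r τ)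
    {Γ : ℝ} (hΓ1 : 1 ≤ Γ) (hΓ : ∀ t ∈ Icc a b, ∫ τ in a..t, r τ ≤ Γ)
    {κ₁ κ₂ κ₃ lam₀ lam₁ lam₂ e : ℝ} (hκ₁ : 0 ≤ κ₁) (hκ₂ : 0 ≤ κ₂) (hκ₃ : 0 ≤ κ₃)
    (hl₀ : 0 ≤ lam₀) (hl₁ : 0 ≤ lam₁) (hl₂ : 0 ≤ lam₂) (he0 : 0 ≤ e)
    (hu0 : ∀ t ∈ Icc a b, ∀ x, Torus.partialDeriv k (u t) x = 0)
    (hu1 : ∀ t ∈ Icc a b, ∀ x (v : EuclideanSpace ℝ (Fin 2)),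
      |⟪Torus.partialDeriv k' (u t) x, v⟫_ℝ| ≤ r t * |v k|)
    (hu2 : ∀ t ∈ Icc a b, ∀ x (v : EuclideanSpace ℝ (Fin 2)),
      |⟪Torus.partialDeriv k' (Torus.partialDeriv k' (u t)) x, v⟫_ℝ| ≤ (r t * κ₁) * |v k|)
    (hΩg : ∀ t ∈ Icc a b, ∀ x, ‖Torus.gradient (torusVorticityTensor (u t) 0 1) x‖ ≤ r t * κ₁)
    (hΩ1 : ∀ t ∈ Icc a b, ∀ x m, |Torus.partialDeriv m (torusVorticityTensor (u t) 0 1) x| ≤ r t * κ₁)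
    (hΩ2 : ∀ t ∈ Icc a b, ∀ x i m,
      |Torus.partialDeriv i (Torus.partialDeriv m (torusVorticityTensor (u t) 0 1)) x| ≤ r t * κ₂)
    (hΩ3 : ∀ t ∈ Icc a b, ∀ x i l m,
      |Torus.partialDeriv i (Torus.partialDeriv l (Torus.partialDeriv m (torusVorticityTensor (u t) 0 1))) x| ≤
        r t * κ₃)
    (hc0 : ∀ t ∈ Icc a b,
      Real.sqrt (∫ x, (Torus.partialDeriv 0 (g t) x 1 - Torus.partialDeriv 1 (g t) x 0) ^ 2) ≤ r t * lam₀)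
    (hc1 : ∀ t ∈ Icc a b,
      Real.sqrt (scalarGradNormSq (fun x => Torus.partialDeriv 0 (g t) x 1 - Torus.partialDeriv 1 (g t) x 0)) ≤
        r t * lam₁)
    (hc2 : ∀ t ∈ Icc a b,
      Real.sqrt (∑ i, ∑ m, ∫ x, (Torus.partialDeriv i (Torus.partialDeriv m
        (fun x => Torus.partialDeriv 0 (g t) x 1 - Torus.partialDeriv 1 (g t) x 0)) x) ^ 2) ≤ r t * lam₂)
    (he : ∀ t ∈ Icc a b, Real.sqrt (∫ x, ‖w t x‖ ^ 2) ≤ e)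
    {t : ℝ} (ht : t ∈ Icc a b) :
    -- level 0
    Real.sqrt (∫ x, torusVorticityTensor (w t) 0 1 x ^ 2) ≤
        Real.sqrt (∫ x, torusVorticityTensor (w a) 0 1 x ^ 2) + Γ * (lam₀ + κ₁ * e) ∧
    -- level 1
    Real.sqrt (∫ x, (Torus.partialDeriv k (torusVorticityTensor (w t) 0 1) x) ^ 2) +
        Real.sqrt (∫ x, (Torus.partialDeriv k' (torusVorticityTensor (w t) 0 1) x) ^ 2) ≤
      (1 + Γ) * (Real.sqrt (∫ x, (Torus.partialDeriv k (torusVorticityTensor (w a) 0 1) x) ^ 2) +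
          Real.sqrt (∫ x, (Torus.partialDeriv k' (torusVorticityTensor (w a) 0 1) x) ^ 2)) +
        (2 + Γ) * Γ * (lam₁ + 2 * (κ₁ * (Real.sqrt (∫ x, torusVorticityTensor (w a) 0 1 x ^ 2) + Γ * (lam₀ + κ₁ * e)) +
          Real.sqrt 2 * κ₂ * e)) ∧
    -- level 2
    Real.sqrt (∫ x, (Torus.partialDeriv k (Torus.partialDeriv k (torusVorticityTensor (w t) 0 1)) x) ^ 2) +
        Real.sqrt (∫ x, (Torus.partialDeriv k (Torus.partialDeriv k' (torusVorticityTensor (w t) 0 1)) x) ^ 2) +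
        Real.sqrt (∫ x, (Torus.partialDeriv k' (Torus.partialDeriv k' (torusVorticityTensor (w t) 0 1)) x) ^ 2) ≤
      (1 + Γ + Γ ^ 2) *
          (Real.sqrt (∫ x, (Torus.partialDeriv k (Torus.partialDeriv k (torusVorticityTensor (w a) 0 1)) x) ^ 2) +
            Real.sqrt (∫ x, (Torus.partialDeriv k (Torus.partialDeriv k' (torusVorticityTensor (w a) 0 1)) x) ^ 2) +
            Real.sqrt (∫ x, (Torus.partialDeriv k' (Torus.partialDeriv k' (torusVorticityTensor (w a) 0 1)) x) ^ 2) +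
            3 * Γ * (lam₂ + 2 * (κ₁ *
              ((1 + Γ) * (Real.sqrt (∫ x, (Torus.partialDeriv k (torusVorticityTensor (w a) 0 1) x) ^ 2) +
                  Real.sqrt (∫ x, (Torus.partialDeriv k' (torusVorticityTensor (w a) 0 1) x) ^ 2)) +
                (2 + Γ) * Γ * (lam₁ + 2 * (κ₁ * (Real.sqrt (∫ x, torusVorticityTensor (w a) 0 1 x ^ 2) +
                  Γ * (lam₀ + κ₁ * e)) + Real.sqrt 2 * κ₂ * e))) +
              2 * Real.sqrt 2 * κ₂ * (Real.sqrt (∫ x, torusVorticityTensor (w a) 0 1 x ^ 2) + Γ * (lam₀ + κ₁ * e)) +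
              2 * κ₃ * e))) +
        Γ * κ₁ * (Real.sqrt (∫ x, (Torus.partialDeriv k (torusVorticityTensor (w a) 0 1) x) ^ 2) +
          Γ * (lam₁ + 2 * (κ₁ * (Real.sqrt (∫ x, torusVorticityTensor (w a) 0 1 x ^ 2) + Γ * (lam₀ + κ₁ * e)) +
            Real.sqrt 2 * κ₂ * e))) := by
  -- ### packaging: the response vorticity is a forced passive scalar of the background
  have h := linearisedNSForced_isClassicalScalarTransportForcedOn_vorticity_fin_two hu hudiv hw hq hwdiv hlin hab
  have hgst := linearisedNSForced_isSmoothSpaceTimeOn_force hu hw hq hlin hab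
  have hU : UniqueDiffOn ℝ (Icc a b) := uniqueDiffOn_Icc hab
  have hcst : Torus.IsSmoothSpaceTimeOn (Icc a b)
      (fun τ x => Torus.partialDeriv 0 (g τ) x 1 - Torus.partialDeriv 1 (g τ) x 0) :=
    ((hgst.partialDeriv hU 0).apply 1).sub ((hgst.partialDeriv hU 1).apply 0)
  have hΩst : Torus.IsSmoothSpaceTimeOn (Icc a b) (fun τ => torusVorticityTensor (u τ) 0 1) :=
    isSmoothSpaceTimeOn_torusVorticityTensor hu hab 0 1
  have hωst : Torus.IsSmoothSpaceTimeOn (Icc a b) (fun τ x => torusVorticityTensor (w τ) 0 1 x) := h.smooth_scalar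
  have hΓ0 : 0 ≤ Γ := zero_le_one.trans hΓ1
  -- names for the sizes at `a` and the derived constants
  obtain ⟨Za, hZa⟩ : ∃ x : ℝ, x = Real.sqrt (∫ x, torusVorticityTensor (w a) 0 1 x ^ 2) := ⟨_, rfl⟩
  obtain ⟨Wk, hWk⟩ : ∃ x : ℝ, x = Real.sqrt (∫ x, (Torus.partialDeriv k (torusVorticityTensor (w a) 0 1) x) ^ 2) :=
    ⟨_, rfl⟩
  obtain ⟨Wk', hWk'⟩ : ∃ x : ℝ, x = Real.sqrt (∫ x, (Torus.partialDeriv k' (torusVorticityTensor (w a) 0 1) x) ^ 2) :=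
    ⟨_, rfl⟩
  obtain ⟨Vkk, hVkk⟩ : ∃ x : ℝ,
      x = Real.sqrt (∫ x, (Torus.partialDeriv k (Torus.partialDeriv k (torusVorticityTensor (w a) 0 1)) x) ^ 2) :=
    ⟨_, rfl⟩
  obtain ⟨Vkk', hVkk'⟩ : ∃ x : ℝ,
      x = Real.sqrt (∫ x, (Torus.partialDeriv k (Torus.partialDeriv k' (torusVorticityTensor (w a) 0 1)) x) ^ 2) :=
    ⟨_, rfl⟩
  obtain ⟨Vk'k', hVk'k'⟩ : ∃ x : ℝ,
      x = Real.sqrt (∫ x, (Torus.partialDeriv k' (Torus.partialDeriv k' (torusVorticityTensor (w a) 0 1)) x) ^ 2) :=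
    ⟨_, rfl⟩
  obtain ⟨Zp, hZp⟩ : ∃ x : ℝ, x = Za + Γ * (lam₀ + κ₁ * e) := ⟨_, rfl⟩
  obtain ⟨P₁, hP₁⟩ : ∃ x : ℝ, x = lam₁ + 2 * (κ₁ * Zp + Real.sqrt 2 * κ₂ * e) := ⟨_, rfl⟩
  obtain ⟨Sp, hSp⟩ : ∃ x : ℝ, x = (1 + Γ) * (Wk + Wk') + (2 + Γ) * Γ * P₁ := ⟨_, rfl⟩
  obtain ⟨P₂, hP₂⟩ : ∃ x : ℝ, x = lam₂ + 2 * (κ₁ * Sp + 2 * Real.sqrt 2 * κ₂ * Zp + 2 * κ₃ * e) := ⟨_, rfl⟩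
  rw [← hZa, ← hWk, ← hWk', ← hVkk, ← hVkk', ← hVk'k']
  rw [← hZp]; rw [← hP₁]; rw [← hSp]; rw [← hP₂]
  have hZa0 : 0 ≤ Za := by rw [hZa]; exact Real.sqrt_nonneg _
  have hWk0 : 0 ≤ Wk := by rw [hWk]; exact Real.sqrt_nonneg _
  have hWk'0 : 0 ≤ Wk' := by rw [hWk']; exact Real.sqrt_nonneg _
  have hVkk0 : 0 ≤ Vkk := by rw [hVkk]; exact Real.sqrt_nonneg _
  have hVkk'0 : 0 ≤ Vkk' := by rw [hVkk']; exact Real.sqrt_nonneg _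
  have hVk'k'0 : 0 ≤ Vk'k' := by rw [hVk'k']; exact Real.sqrt_nonneg _
  have hZp0 : 0 ≤ Zp := by rw [hZp]; positivity
  have hP₁0 : 0 ≤ P₁ := by rw [hP₁]; positivity
  have hSp0 : 0 ≤ Sp := by rw [hSp]; positivity
  have hP₂0 : 0 ≤ P₂ := by rw [hP₂]; positivity
  have hΓt : ∀ t ∈ Icc a b, 0 ≤ ∫ τ in a..t, r τ := fun t ht => integral_nonneg_of_mem_Icc ht hr0
  have hab' : b ∈ Icc a b := right_mem_Icc.2 hab.le
  have hΓb : ∫ τ in a..b, r τ ≤ Γ := hΓ b hab'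
  have hΓb0 : 0 ≤ ∫ τ in a..b, r τ := hΓt b hab'
  -- ### level 0
  have hsrc0 : ∀ τ ∈ Icc a b, Real.sqrt (∫ x, ((Torus.partialDeriv 0 (g τ) x 1 - Torus.partialDeriv 1 (g τ) x 0) -
      ⟪w τ x, Torus.gradient (torusVorticityTensor (u τ) 0 1) x⟫_ℝ) ^ 2) ≤ r τ * (lam₀ + κ₁ * e) := by
    intro τ hτ
    have hcτ : IsSmooth (fun x => Torus.partialDeriv 0 (g τ) x 1 - Torus.partialDeriv 1 (g τ) x 0) :=
      hcst.isSmooth_slice hτ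
    have hwτ : IsSmooth (w τ) := hw.isSmooth_slice hτ
    have hΩτ : IsSmooth (torusVorticityTensor (u τ) 0 1) := hΩst.isSmooth_slice hτ
    have c1 : Continuous fun x => Torus.partialDeriv 0 (g τ) x 1 - Torus.partialDeriv 1 (g τ) x 0 := hcτ.continuous
    have c2 : Continuous fun x => ⟪w τ x, Torus.gradient (torusVorticityTensor (u τ) 0 1) x⟫_ℝ :=
      hwτ.continuous.inner hΩτ.gradient.continuous
    have i1 := sqrt_integral_sub_sq_le' c1 c2
    have i2 := sqrt_integral_inner_sq_le' hwτ.continuous hΩτ.gradient.continuous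
      (mul_nonneg (hr0 τ hτ) hκ₁) (hΩg τ hτ)
    have i3 := hc0 τ hτ
    have i4 := he τ hτ
    have i5 : r τ * κ₁ * Real.sqrt (∫ x, ‖w τ x‖ ^ 2) ≤ r τ * κ₁ * e :=
      mul_le_mul_of_nonneg_left i4 (mul_nonneg (hr0 τ hτ) hκ₁)
    have e1 : r τ * (lam₀ + κ₁ * e) = r τ * lam₀ + r τ * κ₁ * e := by ring
    rw [e1]
    linarith [i1, i2, i3, i5]
  have hG₀c : ContinuousOn (fun τ => r τ * (lam₀ + κ₁ * e)) (Icc a b) := (hr.mul continuous_const).continuousOn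
  have hZ : ∀ τ ∈ Icc a b, Real.sqrt (∫ x, torusVorticityTensor (w τ) 0 1 x ^ 2) ≤ Zp := by
    intro τ hτ
    have h0 := h.sqrt_integral_sq_le hν Subset.rfl (G := fun τ => r τ * (lam₀ + κ₁ * e)) hG₀c
      (fun σ hσ => mul_nonneg (hr0 σ hσ) (by positivity)) hsrc0 hτ
    rw [intervalIntegral.integral_mul_const] at h0
    have h1 : (∫ σ in a..τ, r σ) * (lam₀ + κ₁ * e) ≤ Γ * (lam₀ + κ₁ * e) :=
      mul_le_mul_of_nonneg_right (hΓ τ hτ) (by positivity)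
    rw [hZp, hZa]
    exact h0.trans (by linarith)
  -- ### level 1
  have hsrc1 : ∀ τ ∈ Icc a b, ∀ m : Fin 2, Real.sqrt (∫ x, (Torus.partialDeriv m
      (fun x => (Torus.partialDeriv 0 (g τ) x 1 - Torus.partialDeriv 1 (g τ) x 0) -
        ⟪w τ x, Torus.gradient (torusVorticityTensor (u τ) 0 1) x⟫_ℝ) x) ^ 2) ≤ r τ * P₁ := by
    intro τ hτ m
    have hcτ : IsSmooth (fun x => Torus.partialDeriv 0 (g τ) x 1 - Torus.partialDeriv 1 (g τ) x 0) :=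
      hcst.isSmooth_slice hτ
    have hwτ : IsSmooth (w τ) := hw.isSmooth_slice hτ
    have hΩτ : IsSmooth (torusVorticityTensor (u τ) 0 1) := hΩst.isSmooth_slice hτ
    have hsτ := h.smooth_source.isSmooth_slice hτ
    have i1 := sqrt_integral_partialDeriv_sq_le_sqrt_scalarGradNormSq hsτ m
    have i2 := sqrt_scalarGradNormSq_vorticitySource_le_fin_two hΩτ hcτ hwτ (hwdiv τ hτ)
      (mul_nonneg (hr0 τ hτ) hκ₁) (mul_nonneg (hr0 τ hτ) hκ₂) (hΩ1 τ hτ) (hΩ2 τ hτ)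
    have i3 := hc1 τ hτ
    have i4 := hZ τ hτ
    have i5 := he τ hτ
    have hr' := hr0 τ hτ
    have i6 : r τ * κ₁ * Real.sqrt (∫ x, torusVorticityTensor (w τ) 0 1 x ^ 2) ≤ r τ * κ₁ * Zp :=
      mul_le_mul_of_nonneg_left i4 (by positivity)
    have i7 : Real.sqrt 2 * (r τ * κ₂) * Real.sqrt (∫ x, ‖w τ x‖ ^ 2) ≤ Real.sqrt 2 * (r τ * κ₂) * e :=
      mul_le_mul_of_nonneg_left i5 (by positivity)
    have e1 : r τ * P₁ = r τ * lam₁ + 2 * (r τ * κ₁ * Zp + Real.sqrt 2 * (r τ * κ₂) * e) := by rw [hP₁]; ring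
    rw [e1]
    linarith [i1, i2, i3, i6, i7]
  have hσ₁c : Continuous fun τ => r τ * P₁ := hr.mul continuous_const
  have hσ₁0 : ∀ τ ∈ Icc a b, 0 ≤ r τ * P₁ := fun τ hτ => mul_nonneg (hr0 τ hτ) hP₁0
  have hS : ∀ τ ∈ Icc a b,
      Real.sqrt (∫ x, (Torus.partialDeriv k (torusVorticityTensor (w τ) 0 1) x) ^ 2) +
        Real.sqrt (∫ x, (Torus.partialDeriv k' (torusVorticityTensor (w τ) 0 1) x) ^ 2) ≤ Sp := by
    intro τ hτ
    obtain ⟨h1, h2⟩ := slot_level_one hab h hν hu0 hu1 hr hr0 hσ₁c hσ₁0 hσ₁c hσ₁0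
      (fun σ hσ => hsrc1 σ hσ k) (fun σ hσ => hsrc1 σ hσ k') hτ
    simp only [intervalIntegral.integral_mul_const, ← hWk, ← hWk'] at h1 h2
    have j1 : (∫ σ in a..b, r σ) * P₁ ≤ Γ * P₁ := mul_le_mul_of_nonneg_right hΓb hP₁0
    have j2 : (∫ σ in a..b, r σ) * (Wk + (∫ σ in a..b, r σ) * P₁) ≤ Γ * (Wk + Γ * P₁) :=
      mul_le_mul hΓb (by linarith) (by positivity) hΓ0
    rw [hSp]
    linarith [h1, h2, j1, j2, mul_nonneg hΓ0 hWk'0]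
  refine ⟨hZ t ht, hS t ht, ?_⟩
  -- ### level 2
  have hsrc2 : ∀ τ ∈ Icc a b, ∀ i m : Fin 2, Real.sqrt (∫ x, (Torus.partialDeriv i (Torus.partialDeriv m
      (fun x => (Torus.partialDeriv 0 (g τ) x 1 - Torus.partialDeriv 1 (g τ) x 0) -
        ⟪w τ x, Torus.gradient (torusVorticityTensor (u τ) 0 1) x⟫_ℝ)) x) ^ 2) ≤ r τ * P₂ := by
    intro τ hτ i m
    have hcτ : IsSmooth (fun x => Torus.partialDeriv 0 (g τ) x 1 - Torus.partialDeriv 1 (g τ) x 0) :=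
      hcst.isSmooth_slice hτ
    have hwτ : IsSmooth (w τ) := hw.isSmooth_slice hτ
    have hΩτ : IsSmooth (torusVorticityTensor (u τ) 0 1) := hΩst.isSmooth_slice hτ
    have hωτ : IsSmooth (torusVorticityTensor (w τ) 0 1) := hωst.isSmooth_slice hτ
    have i1 := sqrt_integral_pdpd_sq_le_sqrt_sum
      (fun x => (Torus.partialDeriv 0 (g τ) x 1 - Torus.partialDeriv 1 (g τ) x 0) -
        ⟪w τ x, Torus.gradient (torusVorticityTensor (u τ) 0 1) x⟫_ℝ) i m
    have i2 := sqrt_sum_vorticitySource_le_fin_two hΩτ hcτ hwτ (hwdiv τ hτ)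
      (mul_nonneg (hr0 τ hτ) hκ₁) (mul_nonneg (hr0 τ hτ) hκ₂) (mul_nonneg (hr0 τ hτ) hκ₃)
      (hΩ1 τ hτ) (hΩ2 τ hτ) (hΩ3 τ hτ)
    have i3 := hc2 τ hτ
    have i4 := hZ τ hτ
    have i5 := he τ hτ
    -- `‖∇ω‖₂ ≤ W₀ + W₁ = W_k + W_k' ≤ S⁺`
    have i6 : Real.sqrt (scalarGradNormSq (torusVorticityTensor (w τ) 0 1)) ≤ Sp := by
      have h01 := sqrt_scalarGradNormSq_le_add_fin_two hωτ
      have hS' := hS τ hτ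
      have hperm : Real.sqrt (∫ x, (Torus.partialDeriv 0 (torusVorticityTensor (w τ) 0 1) x) ^ 2) +
          Real.sqrt (∫ x, (Torus.partialDeriv 1 (torusVorticityTensor (w τ) 0 1) x) ^ 2) =
          Real.sqrt (∫ x, (Torus.partialDeriv k (torusVorticityTensor (w τ) 0 1) x) ^ 2) +
          Real.sqrt (∫ x, (Torus.partialDeriv k' (torusVorticityTensor (w τ) 0 1) x) ^ 2) := by
        fin_cases k <;> fin_cases k'
        · exact absurd rfl hkk'
        · rfl
        · exact add_comm _ _
        · exact absurd rfl hkk'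
      linarith
    have hr' := hr0 τ hτ
    have i7 : r τ * κ₁ * Real.sqrt (scalarGradNormSq (torusVorticityTensor (w τ) 0 1)) ≤ r τ * κ₁ * Sp :=
      mul_le_mul_of_nonneg_left i6 (by positivity)
    have i8 : 2 * Real.sqrt 2 * (r τ * κ₂) * Real.sqrt (∫ x, torusVorticityTensor (w τ) 0 1 x ^ 2) ≤
        2 * Real.sqrt 2 * (r τ * κ₂) * Zp := mul_le_mul_of_nonneg_left i4 (by positivity)
    have i9 : 2 * (r τ * κ₃) * Real.sqrt (∫ x, ‖w τ x‖ ^ 2) ≤ 2 * (r τ * κ₃) * e :=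
      mul_le_mul_of_nonneg_left i5 (by positivity)
    have e1 : r τ * P₂ = r τ * lam₂ + 2 * (r τ * κ₁ * Sp + 2 * Real.sqrt 2 * (r τ * κ₂) * Zp + 2 * (r τ * κ₃) * e) := by
      rw [hP₂]; ring
    rw [e1]
    linarith [i1, i2, i3, i7, i8, i9]
  have hσ₂c : Continuous fun τ => r τ * P₂ := hr.mul continuous_const
  have hσ₂0 : ∀ τ ∈ Icc a b, 0 ≤ r τ * P₂ := fun τ hτ => mul_nonneg (hr0 τ hτ) hP₂0
  have hβc : Continuous fun τ => r τ * κ₁ := hr.mul continuous_const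
  have hβ0 : ∀ τ ∈ Icc a b, 0 ≤ r τ * κ₁ := fun τ hτ => mul_nonneg (hr0 τ hτ) hκ₁
  obtain ⟨h1, h2, h3⟩ := slot_level_two hab h hν hu0 hu1 hu2 hr hr0 hβc hβ0 hσ₁c hσ₁0 hσ₂c hσ₂0 hσ₂c hσ₂0
    hσ₂c hσ₂0 (fun σ hσ => hsrc1 σ hσ k) (fun σ hσ => hsrc2 σ hσ k k) (fun σ hσ => hsrc2 σ hσ k k')
    (fun σ hσ => hsrc2 σ hσ k' k') ht
  simp only [intervalIntegral.integral_mul_const, ← hWk, ← hVkk, ← hVkk', ← hVk'k'] at h1 h2 h3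
  obtain ⟨I, hI⟩ : ∃ x : ℝ, x = ∫ σ in a..b, r σ := ⟨_, rfl⟩
  simp only [← hI] at h1 h2 h3 hΓb hΓb0
  -- replace `I ≤ Γ` everywhere (all coefficients nonnegative)
  have j1 : I * P₂ ≤ Γ * P₂ := mul_le_mul_of_nonneg_right hΓb hP₂0
  have j2 : I * P₁ ≤ Γ * P₁ := mul_le_mul_of_nonneg_right hΓb hP₁0
  have j3 : I * (Vkk + I * P₂) ≤ Γ * (Vkk + Γ * P₂) := mul_le_mul hΓb (by linarith) (by positivity) hΓ0
  have j4 : I * κ₁ * (Wk + I * P₁) ≤ Γ * κ₁ * (Wk + Γ * P₁) :=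
    mul_le_mul (mul_le_mul_of_nonneg_right hΓb hκ₁) (by linarith) (by positivity) (by positivity)
  have j5 : 2 * I * (Vkk' + I * P₂) ≤ 2 * Γ * (Vkk' + Γ * P₂) :=
    mul_le_mul (by linarith) (by linarith) (by positivity) (by positivity)
  have j6 : I ^ 2 * (Vkk + I * P₂) ≤ Γ ^ 2 * (Vkk + Γ * P₂) :=
    mul_le_mul (pow_le_pow_left₀ hΓb0 hΓb 2) (by linarith) (by positivity) (by positivity)
  have hΓsq : Γ ≤ Γ ^ 2 := by
    have h := mul_le_mul_of_nonneg_left hΓ1 hΓ0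
    calc Γ = Γ * 1 := (mul_one Γ).symm
      _ ≤ Γ * Γ := h
      _ = Γ ^ 2 := (sq Γ).symm
  have k1 : Γ * Vkk' ≤ Γ ^ 2 * Vkk' := mul_le_mul_of_nonneg_right hΓsq hVkk'0
  have k2 : 0 ≤ Γ * Vk'k' := mul_nonneg hΓ0 hVk'k'0
  have k3 : 0 ≤ Γ ^ 2 * Vk'k' := by positivity
  have k4 : 0 ≤ Γ ^ 3 * P₂ := by positivity
  have hfin := add_le_add (add_le_add h1 h2) h3
  linarith [hfin, j1, j2, j3, j4, j5, j6, k1, k2, k3, k4]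

end Slot

end Summit.AnomalousDissipation.AnomalousDissipation.Theorems.SawtoothPulseCascade.LipAgmon

end
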